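import Literature.NumberTheory.ModularForms.GammaTranslatesDescent
import Literature.NumberTheory.ModularForms.EisensteinLatticeCosetFaithful
import HarnessLib

/-!
# The `q`-expansion principle for `SL₂(ℤ)`-translates, rationality half: translates of a
# form on `Γ(N)` with `K`-rational `q_N`-expansion are `K`-rational (`K ∋ ζ_N`)

Topic `Literature/NumberTheory/ModularForms`; namespace `Literature.NumberTheory.ModularForms`.
Conclusion of `GammaTranslatesSetup/Cramer/Descent` (Shimura 1971, Thm. 6.6 with Prop. 6.9:
`𝔉_N`, the field of modular functions of level `N` with Fourier coefficients in `ℚ(ζ_N)`, is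
stable under `SL₂(ℤ)`; here for forms of a fixed weight, which is what Sturm's theorem consumes):

* `eisE N u = c₄ G_4^u` — the normalised weight-`4` Eisenstein series on `Γ(N)`
  (`EisensteinLatticeCoset*`): in `formSpace Γ(N) 4`, `K`-rational for `K ∋ ζ_N`, permuted by
  `SL₂(ℤ)` (`eisE_slash`), faithfully modulo `±Γ(N)` (`EisensteinLatticeCosetFaithful`);
* `exists_generic_theta` — a `K`-combination `θ = ∑ λ_u c₄G_4^u` with **trivial stabiliser**:
  `θ ∣ γ = θ ⟹ γ ∈ ±Γ(N)` (a vector space over the infinite field `K` is not a finite union of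
  proper subspaces, Mathlib `Submodule.exists_forall_notMem_of_forall_ne_top`);
* `isRat_slash_of_even` — for EVEN `k`, `g ∈ M_k(Γ(N))` `K`-rational ⟹ every `g ∣_k γ`
  `K`-rational: the translates of `θ` (indexed through `SL₂(ℤ/Nℤ)`, reduction being onto) and
  the corresponding translates of `g` form an orbit datum, and `isRat_of_orbitDatum` applies;
* `isRat_slash` — all weights: for odd `k` (and `N ≥ 3`; for `N ∣ 2` odd-weight forms vanish)
  multiply by the `K`-rational `c₃G_3^{(1,0)} ≢ 0` and divide again (`IsRat.of_mul_left`).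

Everything is proved; the definitions (`eisE`, the orbit bookkeeping) are auxiliary (no named fact).

## References

* [ShimuraIATAF1971] G. Shimura, *Introduction to the arithmetic theory of automorphic
  functions*, Princeton (1971), §6.1–6.2: Thm. 6.6, Prop. 6.9; Prop. 6.1 (the action on `f_a`).
* [DiamondShurman2005] F. Diamond, J. Shurman, *A First Course in Modular Forms*, GTM 228
  (2005), §4.2 (Prop. 4.2.1, Thm. 4.2.3).
-/

noncomputable section

namespace Literature.NumberTheory.ModularForms

open scoped MatrixGroups Real CongruenceSubgroup Matrix ModularForm Topology Manifold
open UpperHalfPlane hiding I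
open Complex Filter Function ModularForm PowerSeries
open Literature.NumberTheory.EllipticCurves.ModularForms (formSpace levelOneSpace mem_formSpace
  mem_formSpace_iff coe_mem_formSpace mul_mem_formSpace pow_mem_formSpace formSpace_mono
  mdifferentiable_of_mem_formSpace slash_eq_of_mem_formSpace isBoundedAtImInfty_slash_of_mem_formSpace
  eq_zero_of_mul_eq_zero_of_mdifferentiable specialLinearGroup_map_surjective formSpace_eq_bot_of_odd
  formSpace_eq_bot_of_neg)

/-! ### The normalised Eisenstein functions `c₄ G_4^u` -/

section Eis

variable (N : ℕ) [NeZero N]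

/-- `E^u = c₄ · G_4^u`, the weight-`4` Eisenstein series of `Γ(N)` over the class of `u`,
normalised to have Fourier coefficients in `ℚ(ζ_N)` (`c₄ = 3! N⁴/(2πi)⁴`).
[cite: DiamondShurman2005, Thm. 4.2.3] -/
def eisE (u : Fin 2 → ZMod N) : ℍ → ℂ := latticeEisensteinNorm N 4 • latticeEisenstein N 4 u

variable {N}

/-- `E^u ∈ M_4(Γ(N))`. [cite: DiamondShurman2005, Prop. 4.2.1] -/
theorem eisE_mem (u : Fin 2 → ZMod N) : eisE N u ∈ formSpace (CongruenceSubgroup.Gamma N) 4 := by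
  have h : (⇑(latticeEisensteinNorm N 4 • latticeEisensteinMF N (k := 4) (by norm_num) u) : ℍ → ℂ) =
      eisE N u := rfl
  exact ⟨_, h⟩

omit [NeZero N] in
/-- **Equivariance**: `E^u ∣_4 γ = E^{uγ}`. [cite: DiamondShurman2005, Prop. 4.2.1] -/
theorem eisE_slash (u : Fin 2 → ZMod N) (γ : SL(2, ℤ)) :
    eisE N u ∣[(4 : ℤ)] γ = eisE N (u ᵥ* γ) := by
  unfold eisE
  rw [ModularForm.SL_smul_slash, latticeEisenstein_slash]

/-- **`K`-rationality**: the `q_N`-expansion of `E^u` has coefficients in any subfield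
`K ∋ ζ_N = e^{2πi/N}`. [cite: DiamondShurman2005, Thm. 4.2.3] -/
theorem isRat_eisE {K : Subfield ℂ} (hζ : cexp (2 * π * Complex.I / N) ∈ K) (u : Fin 2 → ZMod N) :
    IsRat K N (eisE N u) := by
  intro n
  have hmem : latticeEisenstein N 4 u ∈ formSpace (CongruenceSubgroup.Gamma N) 4 :=
    ⟨latticeEisensteinMF N (k := 4) (by norm_num) u, rfl⟩
  unfold eisE
  rw [qExpansion_smul (analyticAt_cuspFunction_of_mem hmem), map_smul, smul_eq_mul]
  exact latticeEisensteinNorm_mul_qExpansion_coeff_mem hζ (by norm_num : 3 ≤ 4) u n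

/-- **Faithfulness**: if `E^{uγ} = E^u` for all `u` then `γ ∈ ±Γ(N)`.
[cite: DiamondShurman2005, §4.2 (Prop. 4.2.1, Thm. 4.2.3)] -/
theorem Gamma_mem_or_neg_mem_of_eisE_eq (γ : SL(2, ℤ)) (h : ∀ u : Fin 2 → ZMod N, eisE N (u ᵥ* γ) = eisE N u) :
    γ ∈ CongruenceSubgroup.Gamma N ∨ -γ ∈ CongruenceSubgroup.Gamma N :=
  Gamma_mem_or_neg_mem_of_latticeEisenstein_vecMul_eq N γ fun u ↦
    smul_right_injective (ℍ → ℂ) (latticeEisensteinNorm_ne_zero N 4) (h u)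

end Eis

/-! ### A `K`-combination of the `E^u` with trivial stabiliser -/

section Generic

variable {N : ℕ} [NeZero N] (K : Subfield ℂ)

/-- The combination `θ_λ^g = ∑_u λ_u E^{ug}` (`g ∈ SL₂(ℤ/Nℤ)`); `θ_λ = θ_λ^1`. [folklore] -/
def thetaComb (coef : (Fin 2 → ZMod N) → K) (g : SL(2, ZMod N)) : ℍ → ℂ :=
  ∑ u : Fin 2 → ZMod N, ((coef u : K) : ℂ) • eisE N (u ᵥ* (g : Matrix (Fin 2) (Fin 2) (ZMod N)))

variable {K}

/-- `θ_λ^g ∈ M_4(Γ(N))`. [folklore] -/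
theorem thetaComb_mem (coef : (Fin 2 → ZMod N) → K) (g : SL(2, ZMod N)) :
    thetaComb K coef g ∈ formSpace (CongruenceSubgroup.Gamma N) 4 :=
  Submodule.sum_mem _ fun _ _ ↦ Submodule.smul_mem _ _ (eisE_mem _)

/-- `θ_λ^g` is `K`-rational (`K ∋ ζ_N`). [folklore] -/
theorem isRat_thetaComb (hζ : cexp (2 * π * Complex.I / N) ∈ K) (coef : (Fin 2 → ZMod N) → K)
    (g : SL(2, ZMod N)) : IsRat K N (thetaComb K coef g) :=
  IsRat.sum (k := 4) _ (fun _ _ ↦ Submodule.smul_mem _ _ (eisE_mem _))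
    fun u _ ↦ IsRat.smul (eisE_mem _) (isRat_eisE hζ _) (coef u).2

/-- **Equivariance**: `θ_λ^g ∣_4 γ = θ_λ^{g γ̄}`. [folklore] -/
theorem thetaComb_slash (coef : (Fin 2 → ZMod N) → K) (g : SL(2, ZMod N)) (γ : SL(2, ℤ)) :
    thetaComb K coef g ∣[(4 : ℤ)] γ = thetaComb K coef (g * (Matrix.SpecialLinearGroup.map (Int.castRingHom (ZMod N))) γ) := by
  unfold thetaComb
  rw [SlashAction.sum_slash]
  refine Finset.sum_congr rfl fun u _ ↦ ?_
  rw [ModularForm.SL_smul_slash, eisE_slash, Matrix.SpecialLinearGroup.coe_mul, ← Matrix.vecMul_vecMul]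

/-- **A generic combination has trivial stabiliser**: there is `λ : (ℤ/Nℤ)² → K` such that
`θ_λ ∣_4 γ = θ_λ` forces `γ ∈ ±Γ(N)`.  (For each `g ∈ SL₂(ℤ/Nℤ)` moving some `θ_λ`, the `λ` with
`θ_λ^g = θ_λ` form a proper `K`-subspace; `K` being infinite, some `λ` avoids all of them, and a
`γ` fixing that `θ_λ` reduces to a `g` fixing every `θ_μ`, in particular every `E^u`, whence
`γ ∈ ±Γ(N)` by faithfulness.) [cite: ShimuraIATAF1971, Thm. 6.6 (proof)] -/
theorem exists_generic_theta :
    ∃ coef : (Fin 2 → ZMod N) → K, ∀ γ : SL(2, ℤ),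
      thetaComb K coef 1 ∣[(4 : ℤ)] γ = thetaComb K coef 1 →
        γ ∈ CongruenceSubgroup.Gamma N ∨ -γ ∈ CongruenceSubgroup.Gamma N := by
  classical
  -- the `K`-linear maps `λ ↦ θ_λ^g - θ_λ`
  let D : SL(2, ZMod N) → (Fin 2 → ZMod N) → ℍ → ℂ := fun g u ↦
    eisE N (u ᵥ* (g : Matrix (Fin 2) (Fin 2) (ZMod N))) - eisE N u
  let Φ : SL(2, ZMod N) → ((Fin 2 → ZMod N) → K) →ₗ[K] (ℍ → ℂ) := fun g ↦
    ∑ u : Fin 2 → ZMod N, (LinearMap.proj u : ((Fin 2 → ZMod N) → K) →ₗ[K] K).smulRight (D g u)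
  have hΦ : ∀ g coef, Φ g coef = thetaComb K coef g - thetaComb K coef 1 := by
    intro g coef
    simp only [Φ, D, thetaComb, LinearMap.coe_sum, Finset.sum_apply, LinearMap.smulRight_apply,
      LinearMap.proj_apply, Matrix.SpecialLinearGroup.coe_one, Matrix.vecMul_one, ← Finset.sum_sub_distrib]
    refine Finset.sum_congr rfl fun u _ ↦ ?_
    rw [← smul_sub]
    rfl
  -- the "bad" `g`: those moving some `θ_λ`
  let ι := {g : SL(2, ZMod N) // ∃ coef, Φ g coef ≠ 0}
  have hker : ∀ i : ι, LinearMap.ker (Φ i.1) ≠ ⊤ := by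
    rintro ⟨g, coef, hcoef⟩ htop
    have : coef ∈ LinearMap.ker (Φ g) := htop ▸ Submodule.mem_top
    exact hcoef (LinearMap.mem_ker.mp this)
  obtain ⟨coef, hcoef⟩ := Submodule.exists_forall_notMem_of_forall_ne_top (fun i : ι ↦ LinearMap.ker (Φ i.1)) hker
  refine ⟨coef, fun γ hγ ↦ ?_⟩
  -- `g = γ̄` fixes `θ_coef`, hence is not bad, hence fixes every `E^u`
  have hfix : Φ ((Matrix.SpecialLinearGroup.map (Int.castRingHom (ZMod N))) γ) coef = 0 := by
    rw [hΦ, show (Matrix.SpecialLinearGroup.map (Int.castRingHom (ZMod N))) γ = 1 * (Matrix.SpecialLinearGroup.map (Int.castRingHom (ZMod N))) γ from (one_mul _).symm,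
      ← thetaComb_slash, hγ, sub_self]
  have hgood : ¬ ∃ coef', Φ ((Matrix.SpecialLinearGroup.map (Int.castRingHom (ZMod N))) γ) coef' ≠ 0 := by
    intro hbad
    exact hcoef ⟨(Matrix.SpecialLinearGroup.map (Int.castRingHom (ZMod N))) γ, hbad⟩ (LinearMap.mem_ker.mpr hfix)
  simp only [not_exists, not_not] at hgood
  refine Gamma_mem_or_neg_mem_of_eisE_eq γ fun u ↦ ?_
  have h1 := hgood (Pi.single u 1)
  rw [hΦ] at h1
  simp only [thetaComb, Pi.single_apply] at h1
  rw [Finset.sum_eq_single u (fun v _ hv ↦ by simp [hv]) (fun h ↦ absurd (Finset.mem_univ u) h),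
    Finset.sum_eq_single u (fun v _ hv ↦ by simp [hv]) (fun h ↦ absurd (Finset.mem_univ u) h)] at h1
  simp only [if_true, OneMemClass.coe_one, one_smul, Matrix.SpecialLinearGroup.coe_one, Matrix.vecMul_one,
    sub_eq_zero] at h1
  exact h1

end Generic

/-! ### Even weight: the orbit datum of a generic `θ` and of `g` -/

section Even

variable {K : Subfield ℂ} {N : ℕ} [NeZero N]

omit [NeZero N] in
/-- In even weight, slashing by `-γ` is slashing by `γ`. [folklore] -/
theorem slash_neg_SL2 {k : ℤ} (hk : Even k) (f : ℍ → ℂ) (γ : SL(2, ℤ)) : f ∣[k] (-γ) = f ∣[k] γ := by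
  funext τ
  rw [SL_slash_apply, SL_slash_apply, ModularGroup.SL_neg_smul]
  congr 1
  have : denom (↑(-γ) : GL (Fin 2) ℝ) τ = - denom (γ : GL (Fin 2) ℝ) τ := by
    simp [denom]
    ring
  rw [this, hk.neg.neg_zpow]

omit [NeZero N] in
/-- A form on `Γ(N)` of even weight is invariant under `±Γ(N)`. [folklore] -/
theorem slash_eq_of_mem_or_neg_mem {k : ℤ} (hk : Even k) {g : ℍ → ℂ}
    (hg : g ∈ formSpace (CongruenceSubgroup.Gamma N) k) {δ : SL(2, ℤ)}
    (hδ : δ ∈ CongruenceSubgroup.Gamma N ∨ -δ ∈ CongruenceSubgroup.Gamma N) : g ∣[k] δ = g := by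
  rcases hδ with hδ | hδ
  · exact slash_eq_of_mem_formSpace hg (γ := Matrix.SpecialLinearGroup.mapGL ℝ δ) ⟨δ, hδ, rfl⟩
  · have := slash_eq_of_mem_formSpace hg (γ := Matrix.SpecialLinearGroup.mapGL ℝ (-δ)) ⟨-δ, hδ, rfl⟩
    rwa [show g ∣[k] (Matrix.SpecialLinearGroup.mapGL ℝ (-δ)) = g ∣[k] δ from slash_neg_SL2 hk g δ] at this

omit [NeZero N] in
/-- Slashing by a fixed `γ` is injective on functions. [folklore] -/
theorem slash_injective (k : ℤ) (γ : SL(2, ℤ)) : Function.Injective fun f : ℍ → ℂ ↦ f ∣[k] γ := by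
  intro f₁ f₂ h
  have := congrArg (fun f : ℍ → ℂ ↦ f ∣[k] γ⁻¹) h
  simpa only [← SlashAction.slash_mul, mul_inv_cancel, SlashAction.slash_one] using this

/-- **Rationality of translates, even weight** (Shimura Thm. 6.6 / Prop. 6.9 for forms): for even
`k`, a subfield `K ∋ ζ_N` and `g ∈ M_k(Γ(N))` with `K`-rational `q_N`-expansion, every
`g ∣_k γ`, `γ ∈ SL₂(ℤ)`, has a `K`-rational `q_N`-expansion.  The translates of a generic
`θ = ∑ λ_u c₄G_4^u` (indexed through `SL₂(ℤ/Nℤ)`, onto which `SL₂(ℤ)` reduces) and the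
corresponding translates of `g` form an orbit datum, to which `isRat_of_orbitDatum` applies.
[cite: ShimuraIATAF1971, Thm. 6.6 and Prop. 6.9] -/
theorem isRat_slash_of_even (hζ : cexp (2 * π * Complex.I / N) ∈ K) {k : ℤ} (hk : Even k)
    {g : ℍ → ℂ} (hg : g ∈ formSpace (CongruenceSubgroup.Gamma N) k) (hgK : IsRat K N g)
    (γ₀ : SL(2, ℤ)) : IsRat K N (g ∣[k] γ₀) := by
  classical
  obtain ⟨coef, hstab⟩ := exists_generic_theta (K := K) (N := N)
  -- the translates of `θ`, through `SL₂(ℤ/Nℤ)`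
  set Θ : SL(2, ZMod N) → ℍ → ℂ := thetaComb K coef with hΘ
  have hΘslash : ∀ (gg : SL(2, ZMod N)) (γ : SL(2, ℤ)), Θ gg ∣[(4 : ℤ)] γ =
      Θ (gg * (Matrix.SpecialLinearGroup.map (Int.castRingHom (ZMod N))) γ) :=
    thetaComb_slash coef
  obtain ⟨lift, hlift⟩ : ∃ lift : SL(2, ZMod N) → SL(2, ℤ),
      ∀ gg, (Matrix.SpecialLinearGroup.map (Int.castRingHom (ZMod N))) (lift gg) = gg :=
    ⟨fun gg ↦ (specialLinearGroup_map_surjective N gg).choose,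
      fun gg ↦ (specialLinearGroup_map_surjective N gg).choose_spec⟩
  -- compatibility: equal translates of `θ` give equal translates of `g`
  have hcompat : ∀ a b : SL(2, ℤ), Θ 1 ∣[(4 : ℤ)] a = Θ 1 ∣[(4 : ℤ)] b → g ∣[k] a = g ∣[k] b := by
    intro a b hab
    have h1 : Θ 1 ∣[(4 : ℤ)] (b * a⁻¹) = Θ 1 := by
      rw [SlashAction.slash_mul, ← hab, ← SlashAction.slash_mul, mul_inv_cancel, SlashAction.slash_one]
    have h2 := slash_eq_of_mem_or_neg_mem hk hg (hstab _ h1)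
    calc g ∣[k] a = (g ∣[k] (b * a⁻¹)) ∣[k] a := by rw [h2]
      _ = g ∣[k] b := by rw [← SlashAction.slash_mul, inv_mul_cancel_right]
  -- the orbit as a finite set of functions, enumerated
  let S : Finset (ℍ → ℂ) := Finset.univ.image Θ
  have hSmem : ∀ gg, Θ gg ∈ S := fun gg ↦ Finset.mem_image_of_mem Θ (Finset.mem_univ gg)
  have hS : ∀ x ∈ S, ∃ gg, Θ gg = x := fun x hx ↦ by simpa [S] using hx
  let e : S ≃ Fin S.card := S.equivFin
  let s : Fin S.card → ℍ → ℂ := fun i ↦ (e.symm i : ℍ → ℂ)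
  have hsS : ∀ i, s i ∈ S := fun i ↦ (e.symm i).2
  have hrep' : ∀ i, ∃ gg, Θ gg = s i := fun i ↦ hS _ (hsS i)
  choose rep hrep using hrep'
  let γi : Fin S.card → SL(2, ℤ) := fun i ↦ lift (rep i)
  have hγi : ∀ i, Θ 1 ∣[(4 : ℤ)] γi i = s i := fun i ↦ by rw [hΘslash, one_mul, hlift, hrep]
  have hinj : Function.Injective s := fun i j h ↦ e.symm.injective (Subtype.ext h)
  -- closure of `S` under slashing, and the induced permutations
  have hclosed : ∀ (γ : SL(2, ℤ)) (x : S), (x : ℍ → ℂ) ∣[(4 : ℤ)] γ ∈ S := by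
    intro γ x
    obtain ⟨gg, hgg⟩ := hS _ x.2
    rw [← hgg, hΘslash]
    exact hSmem _
  let φ : SL(2, ℤ) → S → S := fun γ x ↦ ⟨(x : ℍ → ℂ) ∣[(4 : ℤ)] γ, hclosed γ x⟩
  have hφ : ∀ γ, Function.Bijective (φ γ) := fun γ ↦
    (Finite.injective_iff_bijective).mp fun x y h ↦ Subtype.ext (slash_injective 4 γ (congrArg Subtype.val h))
  let σ : SL(2, ℤ) → Equiv.Perm (Fin S.card) := fun γ ↦ (e.symm.trans (Equiv.ofBijective _ (hφ γ))).trans e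
  have hsσ : ∀ γ i, s i ∣[(4 : ℤ)] γ = s (σ γ i) := by
    intro γ i
    simp only [s, σ, Equiv.trans_apply, Equiv.symm_apply_apply, Equiv.ofBijective_apply, φ]
  -- the companions `F_i = g ∣ γ_i`
  let F : Fin S.card → ℍ → ℂ := fun i ↦ g ∣[k] γi i
  have hFσ : ∀ γ i, F i ∣[k] γ = F (σ γ i) := by
    intro γ i
    simp only [F]
    rw [← SlashAction.slash_mul]
    refine hcompat _ _ ?_
    rw [SlashAction.slash_mul, hγi, hsσ, hγi]
  -- the base point `i₀` (`s_{i₀} = θ`, `F_{i₀} = g`)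
  let i₀ : Fin S.card := e ⟨Θ 1, hSmem 1⟩
  have hsi₀ : s i₀ = Θ 1 := by simp [s, i₀]
  have hFi₀ : F i₀ = g := by
    have : Θ 1 ∣[(4 : ℤ)] γi i₀ = Θ 1 ∣[(4 : ℤ)] (1 : SL(2, ℤ)) := by rw [hγi, hsi₀, SlashAction.slash_one]
    simpa only [F, SlashAction.slash_one] using hcompat _ _ this
  have htrans : ∀ i, ∃ γ : SL(2, ℤ), σ γ i₀ = i := fun i ↦
    ⟨γi i, hinj (by rw [← hsσ, hsi₀, hγi])⟩
  -- apply the descent theorem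
  have hmain := isRat_of_orbitDatum (K := K) (w₀ := 4) (k := k) (s := s) (F := F) (σ := σ)
    (fun i ↦ by rw [← hrep i]; exact thetaComb_mem coef _)
    (fun i ↦ slash_mem_formSpace_Gamma hg _) hsσ hFσ hinj
    (fun i ↦ by rw [← hrep i]; exact isRat_thetaComb hζ coef _) i₀ (by rw [hFi₀]; exact hgK) htrans
  -- read off the translate by `γ₀`
  let i₁ : Fin S.card := e ⟨Θ 1 ∣[(4 : ℤ)] γ₀, by rw [hΘslash]; exact hSmem _⟩
  have hsi₁ : s i₁ = Θ 1 ∣[(4 : ℤ)] γ₀ := by simp [s, i₁]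
  have hFi₁ : F i₁ = g ∣[k] γ₀ := hcompat _ _ (by rw [hγi, hsi₁])
  rw [← hFi₁]
  exact hmain i₁

end Even

/-! ### All weights -/

section All

variable {K : Subfield ℂ} {N : ℕ} [NeZero N]

/-- The odd-weight multiplier `E₃ = c₃ G_3^{(1,0)}` and its translates: in `M_3(Γ(N))`,
`K`-rational, and non-vanishing for `N ≥ 3`. [cite: DiamondShurman2005, Thm. 4.2.3] -/
theorem eisThree_slash_spec (hζ : cexp (2 * π * Complex.I / N) ∈ K) (hN : 3 ≤ N) (γ : SL(2, ℤ)) :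
    (latticeEisensteinNorm N 3 • latticeEisenstein N 3 (![1, 0] : Fin 2 → ZMod N)) ∣[(3 : ℤ)] γ ∈
        formSpace (CongruenceSubgroup.Gamma N) 3 ∧
      IsRat K N ((latticeEisensteinNorm N 3 • latticeEisenstein N 3 (![1, 0] : Fin 2 → ZMod N)) ∣[(3 : ℤ)] γ) ∧
      (latticeEisensteinNorm N 3 • latticeEisenstein N 3 (![1, 0] : Fin 2 → ZMod N)) ∣[(3 : ℤ)] γ ≠ 0 := by
  have hslash : (latticeEisensteinNorm N 3 • latticeEisenstein N 3 (![1, 0] : Fin 2 → ZMod N)) ∣[(3 : ℤ)] γ =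
      latticeEisensteinNorm N 3 • latticeEisenstein N 3 ((![1, 0] : Fin 2 → ZMod N) ᵥ* γ) := by
    rw [ModularForm.SL_smul_slash, latticeEisenstein_slash]
  have hmem : ∀ u : Fin 2 → ZMod N, latticeEisenstein N 3 u ∈ formSpace (CongruenceSubgroup.Gamma N) 3 :=
    fun u ↦ ⟨latticeEisensteinMF N (k := 3) le_rfl u, rfl⟩
  rw [hslash]
  refine ⟨Submodule.smul_mem _ _ (hmem _), fun n ↦ ?_, ?_⟩
  · rw [qExpansion_smul (analyticAt_cuspFunction_of_mem (hmem _)), map_smul, smul_eq_mul]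
    exact latticeEisensteinNorm_mul_qExpansion_coeff_mem hζ le_rfl _ n
  · rw [← hslash]
    intro h0
    have h1 : latticeEisensteinNorm N 3 • latticeEisenstein N 3 (![1, 0] : Fin 2 → ZMod N) = 0 :=
      slash_injective 3 γ (by simpa only [SlashAction.zero_slash] using h0)
    exact latticeEisenstein_three_ne_zero N hN
      ((smul_eq_zero_iff_right (latticeEisensteinNorm_ne_zero N 3)).mp h1)

omit [NeZero N] in
/-- For `N ∣ 2`, `-1 ∈ Γ(N)` (inside `GL(2, ℝ)`). [folklore] -/
theorem neg_one_mem_Gamma (hN : N = 1 ∨ N = 2) :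
    (-1 : GL (Fin 2) ℝ) ∈ ((CongruenceSubgroup.Gamma N : Subgroup SL(2, ℤ)) : Subgroup (GL (Fin 2) ℝ)) := by
  have hmem : (-1 : SL(2, ℤ)) ∈ CongruenceSubgroup.Gamma N := by
    rw [CongruenceSubgroup.Gamma_mem]
    have h2 : ((-1 : ℤ) : ZMod N) = 1 := by
      rcases hN with rfl | rfl <;> decide
    simp [h2]
  refine ⟨-1, hmem, ?_⟩
  ext i j
  fin_cases i <;> fin_cases j <;> simp

/-- **Rationality of the `SL₂(ℤ)`-translates of forms on `Γ(N)`** (the rationality half of the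
`q`-expansion principle at all cusps; Shimura Thm. 6.6 with Prop. 6.9): for a subfield
`K ∋ ζ_N` and `g ∈ M_k(Γ(N))` (any weight) with `K`-rational `q_N`-expansion, every `g ∣_k γ`,
`γ ∈ SL₂(ℤ)`, has a `K`-rational `q_N`-expansion.  Odd weight: for `N ≥ 3` multiply by the
`K`-rational `c₃G_3^{(1,0)}` (even total weight), translate, and divide by its non-vanishing
`K`-rational translate; for `N ∣ 2`, `-1 ∈ Γ(N)` kills odd weights.
[cite: ShimuraIATAF1971, Thm. 6.6 and Prop. 6.9] -/
theorem isRat_slash (hζ : cexp (2 * π * Complex.I / N) ∈ K) {k : ℤ} {g : ℍ → ℂ}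
    (hg : g ∈ formSpace (CongruenceSubgroup.Gamma N) k) (hgK : IsRat K N g) (γ₀ : SL(2, ℤ)) :
    IsRat K N (g ∣[k] γ₀) := by
  rcases Int.even_or_odd k with hk | hk
  · exact isRat_slash_of_even hζ hk hg hgK γ₀
  by_cases hN : 3 ≤ N
  · set E₃ : ℍ → ℂ := latticeEisensteinNorm N 3 • latticeEisenstein N 3 (![1, 0] : Fin 2 → ZMod N) with hE₃
    obtain ⟨hE₃mem, hE₃K, -⟩ := eisThree_slash_spec hζ hN 1
    rw [SlashAction.slash_one] at hE₃mem hE₃K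
    obtain ⟨hγmem, hγK, hγne⟩ := eisThree_slash_spec hζ hN γ₀
    have hh : g * E₃ ∈ formSpace (CongruenceSubgroup.Gamma N) (k + 3) := mul_mem_formSpace hg hE₃mem
    have hhK : IsRat K N (g * E₃) := IsRat.mul hg hE₃mem hgK hE₃K
    have heven : Even (k + 3) := hk.add_odd (by decide)
    have hrat := isRat_slash_of_even hζ heven hh hhK γ₀
    rw [ModularForm.mul_slash_SL2] at hrat
    exact IsRat.of_mul_left hγmem (slash_mem_formSpace_Gamma hg γ₀) hγne (mul_comm _ _) hγK hrat
  · have hN' : N = 1 ∨ N = 2 := by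
      have := NeZero.pos N
      omega
    have h0 : g = 0 := by
      have := formSpace_eq_bot_of_odd (neg_one_mem_Gamma hN') hk
      rw [this] at hg
      exact hg
    rw [h0, SlashAction.zero_slash]
    exact isRat_zero

end All

end Literature.NumberTheory.ModularForms

end
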